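import Summits.BirchSwinnertonDyer.Rank1Residual.Additive.PinnedKatoGenusFrameOfRecordRat
import Summits.BirchSwinnertonDyer.Rank1Residual.Additive.RamifiedSevenGenusPartnerTransportRealisation
import Literature.NumberTheory.EllipticCurves.Kato2004.EllipticUnitZetaClassComparisonFree
import Literature.NumberTheory.EllipticCurves.Kato2004.DefinedExpStarBodyIsogenyTransport
import Literature.NumberTheory.EllipticCurves.Kato2004.RayClassArtinTorsionAction
import Literature.NumberTheory.EllipticCurves.Kato2004.AdmissibleZetaClassPositionProofs
import Literature.NumberTheory.EllipticCurves.NewformPeriodRatio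
import Literature.NumberTheory.EllipticCurves.ModularCurveManinSemistableBridgeProofs
import HarnessLib

set_option autoImplicit false

/-!
# `𝒞₇` genus road (crux `EllipticUnitValueSevenOfGZK`, K7r), rows (T5)+(T6) of the (S-D-★′) recipe (pen D1141/D1149): F-P1′
# ∀-ELIMINATED AT THE PARTNER OF RECORD with the member's realised family TRANSPORTED, and READ BACK ON THE MEMBER'S CARRIER

Cell bsd-cm, seat bsd-cm-k-ty1 g35 (literature-prover; explicit unit, claim-free); pen bsd-cm-plan g39 D1141 (recipe), D1147–D1149
((β′) F-P1′); critic idea-crit-15 g18 NOTE #15 (1)–(3) (transport of structure), g19 NOTEs #22–#26.  PURE KERNEL (theorems only): no named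
fact, no `sorry`, no `instance` declaration, no notation; everything landed is untouched.

WHAT.  F-P1′ = `CM.kato15161_ellipticUnitClass_res_zetaFamily_free` (p825229) is printed for a MAXIMAL-order curve `A` and quantifies over
`A`'s own pins `(I, IK)`, its own Kummer frame and ONE realised value-pinned family of `A`.  The (S-D-★′) stub of the crux speaks about a
`𝒞₇` MEMBER `W` (`j ∈ {−3375, 255³}`), its pins `(I, IK)`, its realised family (`hR : ∃ z₀, IsAdmissibleZetaClass W 7 K hK I z₀`) and the
record `D₃ : KummerColumnDataRat …` whose column `euK` is fed through the maximal-order PARTNER `D₃.W₂` by the isogeny pair of record.  This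
file performs the instantiation of F-P1′ at `(A, K, ψ, ι, f, p) := (D₃.W₂, Kcm, D₃.ψ, algClosureEmb ι₀, 7·d, 7)` with EVERYTHING transported
from the member — `I₂ := D₃.transportI I`, `IK₂ := D₃.transportIK IK` (carriers `I.H`, `IK.H`; p823222/p823878), the Kummer frame
`KummerFrame.ofTorsionTower (D₃.W₂.baseChange Kcm) 7 (7d) D₃.hf D₃.γ₂` of the record, the CM endomorphism `φ₂ := β ∘ φ ∘ α` (`φ₂² = [−7e²]`),
and the member's realised family pushed forward: newform by `IsNewformOf.of_isIsogenous`, (A1) by `definedExpStarBody_isogeny_transport`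
(p825173), (A3) by `ZetaBody.isogeny_transport`, (A4) by `PartnerTransport.transportQ_proj_eq_levelToLayer` (p823451), (A5′) from the two
catalogued facts `nonempty_modularParametrizationData`, `IsNewformOf.level_eq_conductorNorm` (`exists_ne_zero_rat_mul_realPeriodRat_eq_plusPeriod_of_facts`),
(A6′) by `rfl` — and reads the conclusion back on the member's carrier at the ONE RATIONAL TWIST `𝔟 = (β)`, `(b₀, b₁, N_b) = (β, 0, 1)`
(pen D1120 (H); `H_ε` by (CMT-ℤ) `CM.artin_natCast_smul_torsion.hε_shape`, p821859): `res₂ = res` (`KummerColumnDataRat.resOver_transportI_transportIK`),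
`(φ₂)_* = C(e) • φ_*` on the common carrier (`PartnerTransport.transport_isogenyMap_comp_eq_C_smul`, here), `euK 𝔟 = C(e) • 𝐳(u)`
(`D₃.column` + `transport_isogenyMap_eq_C_smul`), `L(W₂, s) = L(W, s)` Euler-factorwise (`IsIsogenous.LFunction_eq`).  The ★-position of a
given `(k, zOne)` (`ZetaClassPosition`, the frame's pin `zOne_pos`) is ∀-eliminated at the SAME family, so that the two class identities the
junction (K-2) reads through `valOf` share `y` and Kato's multiplier `M̃` (exposed only as `M ≠ 0`, `katoMultiplier_ne_zero`).

## Contents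
* §1 `PartnerTransport.isogenyLayerMapK_comp` (functoriality of `φ_*` on a layer under composition) and ★
  `PartnerTransport.transport_isogenyMap_comp_eq_C_smul` : `(IK₂).isogenyMap (β ∘ φ ∘ α) IK₂ x = C(u) • IK.isogenyMap φ IK x` on the carrier.
* §2 `PartnerFP1.isTwist_span_natCast` (`(β)` is an admissible twist of `𝔣 ∣ (7d)` for `β > 1` prime to `6·7·7d`) and
  `PartnerFP1.torsionLayer_succ_le_layerSubgroup` (the `hV` binder: `Gal(K̄/K(V[7^{n+1}·7d])) ≤ Gal(K̄/Kℚ_n)`).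
* §3 ★★ `PartnerFP1.position_and_member_identity` — the two class identities of record at one realised family of the member:
  (P) `((7^{a₁}·M) • zOne = (u₁·7^{a₂}·7^k) • y` and (F) for every rational twist `β`:
  `(β·7^t·M) • D₃.euK (β) = N(β) • C(e) • ((β − σ_{(β)}) • (C α₀ • w • res y + C α₁ • C(e) • φ_*(w • res y)))` in `IK.H`,
  CONDITIONAL on the displayed named facts F-P1′, (CMT-ℤ), `nonempty_modularParametrizationData`, `IsNewformOf.level_eq_conductorNorm`.

HONEST LABEL: kernel plumbing (∀-elimination of a named fact at transported data); conditional on the four displayed named facts and on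
`hR`; nothing about the VALUES is read here ((K-2) is the next file); no stub of the line of record (zp v21 `kato_perrin_riou_zp`
bf8fc0bc14739463, 5 sorries) closes; stmt-BirchSwinnertonDyer-19945 stays OPEN; `X12.CMRamifiedSeven` is NOT proved; no summit statement is
proved by this seat; BSD is claimed for no curve.

## References
* K. Kato, Astérisque 295 (2004): §12.2 (p. 220), Thm. 12.5 (1) (p. 221), Ex. 13.3 (p. 225), §13.9 and Lemma 13.10 (1) (p. 230), §15.6
  (p. 254), Prop. 15.9 (pp. 258–259), (15.12.1) (p. 263), 15.14 (p. 264), (15.16.1) (p. 265). [Kato2004Asterisque]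
* K. Rubin, *Euler Systems* (2000), App. B §2–§3. [Rubin2000]   J. H. Silverman, *AEC* (2009), III.6.1, III.7.4, III §8. [SilvermanAEC2009]
* E. de Shalit (1987), II §1.3 (11). [deShalit1987]   J.-P. Serre, *Galois Cohomology* (1997), I §2.2. [SerreGaloisCohomology1997]
* Tree: F-P1′ `Kato2004/EllipticUnitZetaClassComparisonFree.lean` (p825229), (T5-nat) `Kato2004/DefinedExpStarBodyIsogenyTransport.lean`
  (p825173), `Additive/RamifiedSevenGenusPartnerTransport*.lean` (p823222/p823364/p823451), `Additive/PinnedKatoGenusFrameOfRecordRat.lean`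
  (p823878), (CMT-ℤ) `Kato2004/RayClassArtinTorsionAction.lean` (p821859); memos `bsd-cm-k-ty1/g34/FP1-CONSUMER-NOTE.md` §5,
  `SD-PROVER-JUNCTION-W5a.md` §5–§6.
-/

noncomputable section

open scoped NumberField TensorProduct
open WeierstrassCurve Field NumberField IsDedekindDomain
open Literature.NumberTheory.IwasawaTheory
open Literature.NumberTheory.GaloisRepresentations Literature.NumberTheory.GaloisRepresentations.LocalWeilDatum
open Literature.NumberTheory.EllipticCurves
open Literature.NumberTheory.EllipticCurves.Rank1Residual
open Literature.NumberTheory.EllipticCurves.IwasawaAlgebra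
open Literature.NumberTheory.EllipticCurves.Kato2004
open Literature.NumberTheory.EllipticCurves.ModularForms
open Literature.NumberTheory.ComplexMultiplication.EllipticUnits
open Summit.BirchSwinnertonDyer.Rank1Residual

namespace Summit.BirchSwinnertonDyer.Rank1Residual.Additive.GenusSeven

/-! ## §1 Functoriality of the layer push-forward under composition; `(β ∘ φ ∘ α)_*` on the transported pin -/

namespace PartnerTransport

section Layer

variable {K : Type} [Field K] {V V' V'' : WeierstrassCurve K} (p : ℕ) [Fact p.Prime]
  [ContinuousSMul ℤ_[p] (V.tateModule p)] [ContinuousSMul ℤ_[p] (V'.tateModule p)] [ContinuousSMul ℤ_[p] (V''.tateModule p)]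

/-- **`(ψ ∘ φ)_* = ψ_* ∘ φ_*` on `H¹(U, T_p·)`** (functoriality of continuous cohomology in the coefficients: both sides are the class of
the cocycle `T_p(ψ ∘ φ) ∘ θ = T_pψ ∘ T_pφ ∘ θ`). [cite: SerreGaloisCohomology1997, I §2.2] [cite: SilvermanAEC2009, III.7.4] -/
theorem isogenyLayerMapK_comp (φ : Isogeny V V') (ψ : Isogeny V' V'') (U : Subgroup (absoluteGaloisGroup K))
    (c : H1 (CM.tateRepK V p) U) :
    isogenyLayerMapK p (ψ.comp φ) U c = isogenyLayerMapK p ψ U (isogenyLayerMapK p φ U c) := by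
  obtain ⟨θ, rfl⟩ := oneCocycleClass_surjective _ c
  rw [isogenyLayerMapK_oneCocycleClass, isogenyLayerMapK_oneCocycleClass, isogenyLayerMapK_oneCocycleClass]
  refine congrArg _ (Subtype.ext (ContinuousMap.ext fun g => ?_))
  rw [contOneCocycles.pushAddHom_apply, contOneCocycles.pushAddHom_apply, contOneCocycles.pushAddHom_apply]
  change TateModule.map p (ψ.comp φ).toAddMonoidHom (θ.1 g) =
    TateModule.map p ψ.toAddMonoidHom (TateModule.map p φ.toAddMonoidHom (θ.1 g))
  refine TateModule.ext fun k => ?_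
  rw [TateModule.proj_map, TateModule.proj_map, TateModule.proj_map]
  exact Isogeny.comp_apply ψ φ _

end Layer

section Transport

variable {K : Type} [Field K] {V V' : WeierstrassCurve K} {p : ℕ} [Fact p.Prime]
  [ContinuousSMul ℤ_[p] (V.tateModule p)] [ContinuousSMul ℤ_[p] (V'.tateModule p)]
  {κ : ZpExtension K p} {γ : absoluteGaloisGroup K}
  (IK : IwasawaH1DataOver V p κ γ) (β : Isogeny V V') (α : Isogeny V' V)
  (e : ℤ) (u : ℤ_[p]ˣ) (hu : (u : ℤ_[p]) = e) (hαβ : ∀ P, α (β P) = e • P) (hβα : ∀ P, β (α P) = e • P)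

/-- ★ **The transported CM operator**: for an endomorphism `φ` of `V/K`, the push-forward of `φ₂ := β ∘ φ ∘ α` (an endomorphism of the
partner `V′`) on the transported pin `IK₂ := transport IK β α …` IS, on the common carrier `IK.H`, `C(u) • IK.isogenyMap φ IK` (`u = e`):
levelwise `(β ∘ φ ∘ α)_* (β_* c) = β_* φ_* (α_* β_* c) = e • β_* φ_* c` (`isogenyLayerMapK_comp`, `α_* β_* = [e]`), and `IK₂.proj` is
jointly injective. [cite: Kato2004Asterisque, §12.2 (p. 220) and 15.14 (p. 264)] [cite: SilvermanAEC2009, III.6.1] -/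
theorem transport_isogenyMap_comp_eq_C_smul (hγ : κ.IsTopGenerator γ) (φ : Isogeny V V) (x : IK.H) :
    (transport IK β α e u hu hαβ hβα).isogenyMap (β.comp (φ.comp α)) (transport IK β α e u hu hαβ hβα) hγ x =
      (PowerSeries.C (u : ℤ_[p]) : IwasawaAlgebra p) • IK.isogenyMap φ IK hγ x := by
  refine ((transport IK β α e u hu hαβ hβα).proj_eq_iff).mp fun n ↦ ?_
  rw [IwasawaH1DataOver.proj_isogenyMap, transport_proj, transport_proj, IK.proj_C_smul, IwasawaH1DataOver.proj_isogenyMap, map_smul,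
    isogenyLayerMapK_comp, isogenyLayerMapK_comp, isogenyLayerMapK_isogenyLayerMapK_of_comp_eq_zsmul p β α hαβ, map_zsmul, map_zsmul,
    zsmul_eq_units_smul hu]

end Transport

end PartnerTransport

/-! ## §2 The rational twist `(β)` and the `hV` binder -/

namespace PartnerFP1

section Twist

variable {Kcm : Type} [Field Kcm] [NumberField Kcm]

/-- **`(β)` is an admissible twist** of any `𝔣 ∣ (7d)`: for `β > 1` prime to `6·7·(7d)`, `IsTwist 7 𝔣 (β)` — prime to `42·𝔣 ∣ (42·7d)` and
`≠ O_K` (norm `β² ≥ 4`). [cite: Kato2004Asterisque, §15.6 (p. 254, "ideals 𝔞 prime to 6p𝔣, 𝔞 ≠ O_K")] -/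
theorem isTwist_span_natCast (h2 : Module.finrank ℚ Kcm = 2) {d : ℕ} {𝔣 : Ideal (𝓞 Kcm)}
    (h𝔣 : 𝔣 ∣ Ideal.span {((7 * d : ℕ) : 𝓞 Kcm)}) {β : ℕ} (hβ : 1 < β) (hβc : β.Coprime (6 * 7 * (7 * d))) :
    IsTwist 7 𝔣 (Ideal.span {((β : ℕ) : 𝓞 Kcm)}) := by
  refine ⟨?_, span_natCast_ne_top h2 hβ⟩
  have h1 : IsCoprime (Ideal.span {((β : ℕ) : 𝓞 Kcm)}) (Ideal.span {((6 * 7 * (7 * d) : ℕ) : 𝓞 Kcm)}) :=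
    (Ideal.isCoprime_span_singleton_iff _ _).mpr hβc.cast
  refine h1.of_isCoprime_of_dvd_right ?_
  rw [katoModulus6, show ((6 * 7 * (7 * d) : ℕ) : 𝓞 Kcm) = ((6 * 7 : ℕ) : 𝓞 Kcm) * ((7 * d : ℕ) : 𝓞 Kcm) by push_cast; ring,
    ← Ideal.span_singleton_mul_span_singleton]
  exact mul_dvd_mul_left _ h𝔣

/-- **The cyclotomic layers sit inside the Kummer levels**: `Gal(K̄/K(V[7^{n+1}·(7d)])) ≤ Gal(K̄/Kℚ_n)` for the restricted cyclotomic tower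
of a quadratic `K` — the `hV` binder of F-P1/F-P1′ for the frame `KummerFrame.ofTorsionTower V 7 (7d) …` (`V (n+1) = torsionLayer V (7^{n+1}·7d)`):
`K(V[7^{n+1}·7d]) ⊇ K(V[7^{n+1}]) ⊇ K(μ_{7^{n+1}}) ⊇ Kℚ_n` (Weil pairing; `NumberFieldColumn` §2–§3).
[cite: SilvermanAEC2009, III §8 Cor. 8.1.1] [cite: Washington1997, §13.1] -/
theorem torsionLayer_succ_le_layerSubgroup [Fact (Nat.Prime 7)] (h2 : Module.finrank ℚ Kcm = 2) (K : ZpExtension ℚ 7)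
    (hK : K.IsCyclotomic) (V : WeierstrassCurve Kcm) [V.IsElliptic] (d n : ℕ) :
    CM.torsionLayer V (7 ^ (n + 1) * (7 * d)) ≤ (K.restrictOfFinrankEqTwo (by decide) Kcm h2).layerSubgroup n := fun σ hσ ↦
  NumberFieldColumn.mem_layerSubgroup_restrict_of_dvd_cyclotomicCharacter_sub_one K hK (by norm_num) _ n σ
    (NumberFieldColumn.dvd_cyclotomicCharacter_sub_one_of_mem_torsionLayer V 7 n σ
      (NumberFieldColumn.torsionLayer_le_of_dvd V ⟨7 * d, rfl⟩ hσ))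

end Twist

/-! ## §3 ★★ The two class identities of record at one realised family of the member -/

set_option maxHeartbeats 4000000 in
/-- ★★ **(T5)+(T6): F-P1′ AT THE PARTNER, TRANSPORTED, READ ON THE MEMBER; WITH THE ★-POSITION AT THE SAME FAMILY.**  For a member `W`
with pins `(K, hK, γ, I)` carrying an admissible zeta class (`hR`), a position datum `(k, zOne)` (`ZetaClassPosition W 7 K hK I k zOne` —
the frame's `zOne_pos`), the genus support `hbad` at an odd `d`, the CM block `(Kcm, h2, s, ι₀)`, the `K`-side pin `IK` over the restricted
tower with generator `γK`, the CM isogeny `φ` (`φ² = [−7]`), a modulus `𝔣 ∣ (7d)` and a record `D₃ : KummerColumnDataRat W Kcm h2 K IK ι₀ 𝔣 d φ`: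
THERE ARE `M ∈ Λ ∖ {0}` (Kato's multiplier `M̃` of ONE realised family of `W`, `katoMultiplier_ne_zero`), its lift `y ∈ I.H`, units
`u₁, w ∈ Λˣ`, exponents `a₁, a₂, t` and `(α₀, α₁) ∈ ℤ₇² ∖ {0}` such that
(P) `(7^{a₁}·M) • zOne = (u₁·7^{a₂}·7^k) • y` in `I.H` (the position pin ∀-eliminated at the family), and
(F) for EVERY `β > 1` prime to `6·7·7d` with `7d ∣ β − 1`:
`(β·7^t·M) • D₃.euK (β) = N((β)) • C(e) • ((β − σ_{(β)}) • (C α₀ • (w • res y) + C α₁ • C(e) • φ_*(w • res y)))` in `IK.H`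
(`σ_{(β)} = binomialSeries (artinExponent …)`, `res = I.resOver IK hγ hγK`, `φ_* = IK.isogenyMap φ IK hγK`, `e = D₃.u ∈ ℤ₇ˣ`) — F-P1′
∀-eliminated at the partner `D₃.W₂` with the transported pins/family and the twist `(β, 0, 1)` whose `H_ε` is (CMT-ℤ), multiplied by `C(e)`
and rewritten on the member's carrier (module docstring).  CONDITIONAL on the displayed named facts `hFP1`, `hCMT`, `hMP`, `hLev`.
[cite: Kato2004Asterisque, §15.16 (15.16.1) (p. 265), 15.14 (p. 264), (15.12.1) (p. 263), Thm. 12.5 (1) (p. 221), §13.9 and Lemma 13.10 (1) (p. 230), §15.6 (p. 254)]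
[cite: deShalit1987, II §1.3 (11)] [cite: Rubin2000, App. B §3] -/
theorem position_and_member_identity
    (hFP1 : CM.kato15161_ellipticUnitClass_res_zetaFamily_free) (hCMT : CM.artin_natCast_smul_torsion)
    (hMP : nonempty_modularParametrizationData)
    (hLev : ∀ {N : ℕ} [NeZero N], IsNewformOf.level_eq_conductorNorm (N := N))
    {W : WeierstrassCurve ℚ} [W.IsElliptic] [W.IsGloballyMinimal] [Fact (Nat.Prime 7)]
    [ContinuousSMul ℤ_[7] (W.tateModule 7)]
    (K : ZpExtension ℚ 7) (hK : K.IsCyclotomic) {γ : absoluteGaloisGroup ℚ} (hγ : K.IsTopGenerator γ)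
    (I : IwasawaH1Data W 7 K γ) (hR : ∃ z₀ : I.H, IsAdmissibleZetaClass W 7 K hK I z₀)
    {k : ℕ} {zOne : I.H} (hpos : ZetaClassPosition W 7 K hK I k zOne)
    {d : ℕ} (hodd : Odd d) (hbad : ∀ (q : ℕ) [Fact q.Prime], q ≠ 7 → (¬ Good W q ↔ q ∣ d))
    (Kcm : Type) [Field Kcm] [NumberField Kcm] (h2 : Module.finrank ℚ Kcm = 2) (s : 𝓞 Kcm) (hs : (s : Kcm) ^ 2 = -7)
    (ι₀ : Kcm →+* ℂ) (hι₀ : ∀ (w : InfinitePlace Kcm) (x : Kcm), ι₀ x = w.embedding x)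
    [ContinuousSMul ℤ_[7] ((W.baseChange Kcm).tateModule 7)]
    {γK : absoluteGaloisGroup Kcm} (hγK : (K.restrictOfFinrankEqTwo (by decide) Kcm h2).IsTopGenerator γK)
    (IK : IwasawaH1DataOver (W.baseChange Kcm) 7 (K.restrictOfFinrankEqTwo (by decide) Kcm h2) γK)
    (φ : Isogeny (W.baseChange Kcm) (W.baseChange Kcm)) (hφ : ∀ P, φ (φ P) = (-7 : ℤ) • P)
    {𝔣 : Ideal (𝓞 Kcm)} (h𝔣 : 𝔣 ∣ Ideal.span {((7 * d : ℕ) : 𝓞 Kcm)})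
    (D₃ : KummerColumnDataRat W Kcm h2 K IK ι₀ 𝔣 d φ) :
    ∃ (M : IwasawaAlgebra 7) (_ : M ≠ 0) (y : I.H) (u₁ w : (IwasawaAlgebra 7)ˣ) (a₁ a₂ t : ℕ) (α₀ α₁ : ℤ_[7])
      (_ : α₀ ≠ 0 ∨ α₁ ≠ 0),
      (((7 : ℕ) : IwasawaAlgebra 7) ^ a₁ * M) • zOne =
          ((u₁ : IwasawaAlgebra 7) * ((7 : ℕ) : IwasawaAlgebra 7) ^ a₂ * ((7 : ℕ) : IwasawaAlgebra 7) ^ k) • y ∧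
      ∀ β : ℕ, 1 < β → β.Coprime (6 * 7 * (7 * d)) → ((7 * d : ℕ) : 𝓞 Kcm) ∣ ((β : ℕ) : 𝓞 Kcm) - 1 →
        ((((β : ℕ) : ℤ) : IwasawaAlgebra 7) * (((7 : ℕ) : IwasawaAlgebra 7) ^ t * M)) • D₃.euK (Ideal.span {((β : ℕ) : 𝓞 Kcm)}) =
          ((Ideal.absNorm (Ideal.span {((β : ℕ) : 𝓞 Kcm)}) : ℕ) : IwasawaAlgebra 7) •
            (PowerSeries.C (D₃.u : ℤ_[7]) : IwasawaAlgebra 7) •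
              (((((β : ℕ) : ℤ) : IwasawaAlgebra 7) -
                  PowerSeries.binomialSeries ℤ_[7]
                    (ZpExtension.artinExponent (K.restrictOfFinrankEqTwo (by decide) Kcm h2) (Ideal.span {((β : ℕ) : 𝓞 Kcm)}))) •
                ((PowerSeries.C α₀ : IwasawaAlgebra 7) • ((w : IwasawaAlgebra 7) • I.resOver IK hγ hγK y) +
                  (PowerSeries.C α₁ : IwasawaAlgebra 7) • (PowerSeries.C (D₃.u : ℤ_[7]) : IwasawaAlgebra 7) •
                    IK.isogenyMap φ IK hγK ((w : IwasawaAlgebra 7) • I.resOver IK hγ hγK y))) := by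
  classical
  -- structure facts of the member and of the partner
  haveI := D₃.isElliptic_W₂
  haveI := D₃.isGloballyMinimal_W₂
  haveI := D₃.continuousSMul_W₂
  haveI : ContinuousSMul ℤ_[7] (D₃.W₂.tateModule 7) := TateModule.continuousSMul_padicInt
  haveI : Module.Free ℤ_[7] (W.tateModule 7) := W.module_free_tateModule_holds 7
  haveI : Module.Finite ℤ_[7] (W.tateModule 7) := W.module_finite_tateModule_holds 7
  haveI : Module.Free ℤ_[7] (D₃.W₂.tateModule 7) := D₃.W₂.module_free_tateModule_holds 7
  haveI : Module.Finite ℤ_[7] (D₃.W₂.tateModule 7) := D₃.W₂.module_finite_tateModule_holds 7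
  haveI : (D₃.W₂.baseChange Kcm).IsElliptic := by
    rw [WeierstrassCurve.baseChange]
    infer_instance
  -- ONE realised family of the member, from `hR` (with its Néron clause (A2))
  obtain ⟨z₀, hz₀⟩ := hR
  obtain ⟨hp, N, hN, nf, hnf, ιcyc, q, Λv, hq, hA12, c, d₁, a, A, d', hA, hc, hd, hdd', hRm, z, x, hZ, y, hy,
    qm, perRatio, e, -, n₁, n₂, n₃, n₄, σc, σd, σℓ, hqm, hspan, h₁, h₂', h₃, h₄, hσc, hσd, hσℓ, hper0, hper, he, -⟩ :=
    (isAdmissibleZetaClass_iff W 7 K hK I z₀).mp hz₀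
  haveI := hN
  -- (P) the ★-position of `zOne`, ∀-eliminated at this family
  obtain ⟨-, u₁, hP⟩ := (zetaClassPosition_iff k zOne).mp hpos hp N hN nf hnf ιcyc q Λv hq hA12 c d₁ a A d' hA hc hd hdd'
    hRm z x hZ y hy qm perRatio e n₁ n₂ n₃ n₄ σc σd σℓ hqm hspan h₁ h₂' h₃ h₄ hσc hσd hσℓ hper0 hper he
  obtain ⟨dg, hDEF, -⟩ := hA12
  -- Kato's multiplier of the family is non-zero
  have hM := katoMultiplier_ne_zero 7 W hnf K c d₁ a A d' hqm.ne' h₁ h₂' h₃ h₄ hRm σc σd σℓ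
  -- partner-side bookkeeping
  have he0 : D₃.e ≠ 0 := by rcases D₃.e_eq with h | h <;> simp [h]
  have hd0 : d ≠ 0 := by
    rintro rfl
    exact (Nat.not_odd_iff_even.mpr (by decide)) hodd
  have hf3 : 3 ≤ 7 * d := by omega
  have hmax : D₃.W₂.j ∈ maximalCMJInvariants := by
    rw [D₃.j_W₂]
    simp [maximalCMJInvariants]
  have hKj : IsCMFieldOfJ Kcm D₃.W₂.j := by
    rw [D₃.j_W₂]
    exact MemberGrossencharacter.isCMFieldOfJ_neg3375 Kcm h2 (s : Kcm) hs
  have hL₂ : ∀ zz : ℂ, 3 / 2 < zz.re → heckeLFunction D₃.ψ zz = D₃.W₂.LSeries zz := fun zz hzz ↦ by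
    rw [D₃.ψ_LSeries zz hzz, IsIsogenous.LSeries_eq D₃.isIsogenous]
  have hιC : ∀ (w : InfinitePlace Kcm) (x : Kcm), algClosureEmb ι₀ (algebraMap Kcm (AlgebraicClosure Kcm) x) = w.embedding x :=
    fun w x ↦ by rw [algClosureEmb_algebraMap, hι₀ w x]
  have hsupp : ∀ (ℓ : ℕ) [Fact ℓ.Prime], ℓ ∣ 7 * d → ℓ ≠ 7 → ¬ D₃.W₂.HasGoodReductionAtPrime ℓ := by
    intro ℓ hℓ hdvd hℓ7 hgood
    have hℓd : ℓ ∣ d := by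
      rcases (Nat.Prime.dvd_mul hℓ.out).mp hdvd with h7 | h
      · exact absurd ((Nat.prime_dvd_prime_iff_eq hℓ.out (by norm_num)).mp h7) hℓ7
      · exact h
    exact ((hbad ℓ hℓ7).mpr hℓd) ((IsIsogenous.hasGoodReductionAtPrime_iff D₃.isIsogenous ℓ).mpr hgood)
  have h₀ := ZpExtension.surjective_comp_absGaloisRestrict_of_finrank_eq_two (p := 7) (by decide) K Kcm h2
  -- the Kummer frame of the partner, its non-vanishing witness, and the cyclotomic layers inside its levels
  have heF : ∃ kk, (KummerFrame.ofTorsionTower (D₃.W₂.baseChange Kcm) 7 (7 * d) D₃.hf D₃.γ₂).e kk ≠ 0 :=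
    ⟨1, fun h0 ↦ D₃.good (by rw [h0, ZeroMemClass.coe_zero, map_zero, map_zero])⟩
  have hV : ∀ n : ℕ, (KummerFrame.ofTorsionTower (D₃.W₂.baseChange Kcm) 7 (7 * d) D₃.hf D₃.γ₂).V (n + 1) ≤
      (K.restrict Kcm h₀).layerSubgroup n := fun n ↦
    torsionLayer_succ_le_layerSubgroup h2 K hK (D₃.W₂.baseChange Kcm) d n
  -- the CM endomorphism of the partner `φ₂ := β ∘ φ ∘ α`, `φ₂² = [−7e²]`
  have hφ₂sq : ∀ P, (D₃.β.comp (φ.comp D₃.α)) ((D₃.β.comp (φ.comp D₃.α)) P) = (-7 * D₃.e ^ 2 : ℤ) • P := fun P ↦ by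
    simp only [Isogeny.comp_apply]
    rw [D₃.αβ, map_zsmul, hφ, map_zsmul, map_zsmul, D₃.βα, smul_smul, smul_smul]
    congr 1
    ring
  have hm : (-7 * D₃.e ^ 2 : ℤ) < 0 := by rcases D₃.e_eq with h | h <;> rw [h] <;> norm_num
  -- the newform and the period ratio of the partner (catalogued facts)
  have hnf₂ : IsNewformOf D₃.W₂ nf := hnf.of_isIsogenous ⟨D₃.ψ₀⟩
  obtain ⟨ϖ, hϖ0, hϖ⟩ := exists_ne_zero_rat_mul_realPeriodRat_eq_plusPeriod_of_facts hMP hLev D₃.W₂ nf hnf₂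
  -- (A1), (A3), (A4) transported along the `ℚ`-pair `(φ₀, ψ₀)` of the record
  obtain ⟨d₂, -, hDEF₂⟩ :=
    definedExpStarBody_isogeny_transport W D₃.W₂ 7 nf ιcyc ((q : ℚ) : ℝ) Λv D₃.φ₀ D₃.ψ₀ he0 D₃.ψφ hDEF
  have hZ₂ := ZetaBody.isogeny_transport 7 nf ιcyc ((q : ℚ) : ℝ) Λv c d₁ a A z x D₃.φ₀ D₃.ψ₀ he0 D₃.ψφ hZ
  have hy₂ : ∀ n : ℕ, (D₃.transportI I).proj n y = levelToLayer D₃.W₂ 7 hK hp (EulerSystemValues.badPlaces c d₁ A N) n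
      (isogenyMapH1 7 D₃.φ₀ ((cyclotomicLevelsRat 7 (EulerSystemValues.badPlaces c d₁ A N)).level (n + 1) ∅)
        (z (n + 1) (cyclotomicLevelsRat 7 (EulerSystemValues.badPlaces c d₁ A N)).idealOne)) := fun n ↦
    PartnerTransport.transportQ_proj_eq_levelToLayer hK hp I D₃.φ₀ D₃.ψ₀ D₃.e D₃.u D₃.u_eq D₃.ψφ D₃.φψ
      (EulerSystemValues.badPlaces c d₁ A N) (fun n ↦ z (n + 1) (cyclotomicLevelsRat 7 (EulerSystemValues.badPlaces c d₁ A N)).idealOne) hy n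
  -- F-P1′ at the partner
  obtain ⟨t, α₀, α₁, hα, w, HF⟩ := hFP1 D₃.W₂ hmax Kcm hKj D₃.ψ D₃.ψ_infinityType hL₂ (algClosureEmb ι₀) hιC (7 * d) hf3
    D₃.ψ_conductor 7 hsupp K hK γ hγ (D₃.transportI I) h₀ γK hγK (D₃.transportIK IK)
    (KummerFrame.ofTorsionTower (D₃.W₂.baseChange Kcm) 7 (7 * d) D₃.hf D₃.γ₂)
    (KummerFrame.ofTorsionTower_V (D₃.W₂.baseChange Kcm) 7 (7 * d) D₃.hf D₃.γ₂) heF hV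
    (D₃.β.comp (φ.comp D₃.α)) (-7 * D₃.e ^ 2) hm hφ₂sq hp N hN nf hnf₂ ιcyc q _ hq ⟨d₂, hDEF₂⟩ c d₁ a A d' hA hc hd hdd'
    hRm _ x hZ₂ y hy₂ qm ϖ (padicValRat 7 (ϖ / (q * qm))) n₁ n₂ n₃ n₄ σc σd σℓ hqm hspan h₁ h₂' h₃ h₄ hσc hσd hσℓ
    hϖ0 hϖ.symm rfl
  -- the Euler factors of the partner are the member's
  rw [IsIsogenous.LFunction_eq D₃.isIsogenous] at hM hP
  refine ⟨_, hM, y, u₁, w, (-e).toNat, e.toNat, t, α₀, α₁, hα, hP, fun β hβ hβc hβf ↦ ?_⟩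
  -- the rational twist `(β)`, its unit tower of Kato representatives, its coordinates `(β, 0, 1)` by (CMT-ℤ)
  have hTw : IsTwist 7 𝔣 (Ideal.span {((β : ℕ) : 𝓞 Kcm)}) := isTwist_span_natCast h2 h𝔣 hβ hβc
  obtain ⟨uT, huT, -, hcol⟩ := D₃.column (Ideal.span {((β : ℕ) : 𝓞 Kcm)}) hTw
  have hcop : IsCoprime (Ideal.span {((β : ℕ) : 𝓞 Kcm)}) (Ideal.span {((6 * 7 * (7 * d) : ℕ) : 𝓞 Kcm)}) :=
    (Ideal.isCoprime_span_singleton_iff _ _).mpr hβc.cast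
  have H := HF (Ideal.span {((β : ℕ) : 𝓞 Kcm)}) hcop uT huT (β : ℤ) 0 1 one_ne_zero fun kk ss hks hss ↦
    hCMT.hε_shape D₃.W₂ hmax Kcm hKj D₃.ψ D₃.ψ_infinityType hL₂ (algClosureEmb ι₀) hιC (7 * d) hf3 D₃.ψ_conductor 7 β hβ
      hβc hβf (⇑(D₃.β.comp (φ.comp D₃.α))) kk ss hks hss _
  simp only [Int.cast_zero, zero_mul, zero_smul, add_zero, Nat.cast_one, one_mul] at H
  -- back to the member's carrier: `res₂ = res`, `(φ₂)_* = C(e) • φ_*`, `euK (β) = C(e) • 𝐳(u)`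
  have hres : (D₃.transportI I).resOver (D₃.transportIK IK) hγ hγK y = I.resOver IK hγ hγK y :=
    D₃.resOver_transportI_transportIK hγ hγK I IK y
  have hφ₂T : ∀ xx : IK.H,
      IwasawaH1DataOver.isogenyMap (κ := K.restrict Kcm h₀) (D₃.β.comp (φ.comp D₃.α)) (D₃.transportIK IK) (D₃.transportIK IK)
          hγK xx =
        (PowerSeries.C (D₃.u : ℤ_[7]) : IwasawaAlgebra 7) • IK.isogenyMap φ IK hγK xx := fun xx ↦
    PartnerTransport.transport_isogenyMap_comp_eq_C_smul IK D₃.β D₃.α D₃.e D₃.u D₃.u_eq D₃.αβ D₃.βα hγK φ xx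
  -- (the left-hand side below is elaborated on the transported carrier, as in F-P1′'s conclusion)
  have heu : (PowerSeries.C (D₃.u : ℤ_[7]) : IwasawaAlgebra 7) •
      KummerFrame.iwasawaClass _ uT (K.restrict Kcm h₀) hV (D₃.transportIK IK) = D₃.euK (Ideal.span {((β : ℕ) : 𝓞 Kcm)}) := by
    have h1 : D₃.euK (Ideal.span {((β : ℕ) : 𝓞 Kcm)}) =
        (D₃.transportIK IK).isogenyMap D₃.α IK hγK (KummerFrame.iwasawaClass _ uT (K.restrict Kcm h₀) hV (D₃.transportIK IK)) :=
      (D₃.transportIK IK).eq_isogenyMap_of_proj_eq D₃.α IK hγK fun n ↦ by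
        rw [hcol n]
        exact congrArg _ (KummerFrame.proj_iwasawaClass_eq_tateClass _ uT (K.restrict Kcm h₀) hV (D₃.transportIK IK) n).symm
    exact (h1.trans (PartnerTransport.transport_isogenyMap_eq_C_smul IK D₃.β D₃.α D₃.e D₃.u D₃.u_eq D₃.αβ D₃.βα hγK _)).symm
  rw [hres, hφ₂T] at H
  have H' := congrArg (fun v ↦ (PowerSeries.C (D₃.u : ℤ_[7]) : IwasawaAlgebra 7) • v) H
  rw [smul_smul, mul_comm (PowerSeries.C (D₃.u : ℤ_[7]) : IwasawaAlgebra 7), ← smul_smul, heu,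
    smul_comm (PowerSeries.C (D₃.u : ℤ_[7]) : IwasawaAlgebra 7)
      ((Ideal.absNorm (Ideal.span {((β : ℕ) : 𝓞 Kcm)}) : ℕ) : IwasawaAlgebra 7)] at H'
  exact H'

end PartnerFP1

end Summit.BirchSwinnertonDyer.Rank1Residual.Additive.GenusSeven

end
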